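import Literature.MathematicalPhysics.QuantumLattice.EtaPairingOptimalGroundStates
import HarnessLib

/-!
# Exact Néel, charge-density-wave, paramagnetic and ferromagnetic ground states of the
# generalized Hubbard model at half filling (de Boer–Schadschneider optimal ground states)

Topic `MathematicalPhysics/QuantumLattice` (family `hubbard`). Cell `pub/hubbard-cq`, seat
`hubbard-pc-lit-1` (competing orders: where, in the nine-parameter nearest-neighbour Hubbard
family, classical Néel / CDW / Ising-paramagnetic / saturated-ferromagnetic product states are
RIGOROUSLY the ground states). WHAT THIS IS NOT: nothing about the plain Hubbard model
(`X = V = Y = J = 0` satisfies none of the regions below except the trivial `t = 0` corners); the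
statements are finite-volume, `T = 0`, for the frustration-free bond-charge point `t = X`
(conservation of the number of doubly occupied sites), and the ground states exhibited need not be
unique (the paramagnetic family is `2^{|Λ|}`-fold degenerate by construction).

## The source

J. de Boer, A. Schadschneider, *Exact ground states of generalized Hubbard models*,
Phys. Rev. Lett. **75** (1995) 4298 (arXiv:cond-mat/9503122), eqs. (11)–(16): with the bond
Hamiltonian `h_{jl}` of their eq. (1) (tree `GenHubbard.bondHamiltonian`: hopping `t`, bond-charge
`X`, `U/Z`, `V`, pair hopping `Y`, `J_xy`, `J_z`, `μ/Z`) and its sixteen local eigenstates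
(eq. (2)), the half-filled product states (eq. (11)–(12))
`|para⟩ = Π_{j∈A} c†_{j↑} Π_{j∈A'} c†_{j↓} |0⟩` (any partition `Λ = A ⊔ A'`),
`|Neel⟩` (the same with `A, A'` the two classes of a bipartite lattice),
`|CDW⟩ = Π_{j∈B} c†_{j↑} c†_{j↓} |0⟩` (`B` one class of a bipartite lattice), `|F⟩ = Π_j c†_{j↑}|0⟩`
are OPTIMAL ground states (every local state occurring in them is a local ground state) under,
respectively (at `μ = 0`, which the source notes is the optimal choice for (13)–(15)):
* (13) `t = X`, `J_xy = J_z = 0`, `U/Z ≥ max(2|t|, V + |Y|, -V)`;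
* (14) `t = X`, `J_xy = 0`, `J_z ≥ 0`, `U/Z ≥ max(-V - J_z/4, 2|t| - J_z/2, V + |Y| - J_z/4)`;
* (15) `t = X`, `Y = 0`, `V ≥ 0`, `-U/Z ≥ max(2|t| - 2V, -V - J_z/4, -V + |J_xy|/2 + J_z/4)`;
* (16) at `t = X`: `-J_z ≥ |J_xy|`, `U/Z ≥ max(2|t| + J_z/2, J_z/4 - V, V + |Y| + J_z/4)`
  (the printed (16) covers `t ≠ X` through the exact `2 × 2` block eigenvalue
  `-8(t-X)²/(J_xy+J_z)`; TODO(general form): only the bond-Gerschgorin case `t = X` is formalised).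

## What is formalised (everything PROVED; no named fact)

Building on the tree's `EtaPairingOptimalGroundStates` (bond Hamiltonian, Gerschgorin data
`diagVal`/`offBound`, `IsMove`, `colOff`, `re_quadForm_ge_of_gershgorin_ge`):
* `bondHamiltonian_re_expect_ge_of_local` / `hamiltonian_re_expect_ge_of_local` — the
  optimal-ground-state lower bound for an ARBITRARY local target energy `E`:
  `(∀ α, E ≤ diagVal - offBound) ⟹ E ‖φ‖² ≤ Re⟨φ, h_{jl} φ⟩`, `#bonds·E·‖φ‖² ≤ Re⟨φ, Hφ⟩`;
* `mulVec_single_of_offBound_eq_zero` — a basis vector none of whose moves is allowed is an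
  eigenvector of `h_{jl}` with eigenvalue `diagVal`;
* the four sixteen-configuration certificates `sixteen_configurations_para/neel/cdw/ferro`
  [dBS (13)–(16)] and the four theorems `para_isGroundState`, `neel_isGroundState`,
  `cdw_isGroundState`, `ferro_isGroundState`: the corresponding occupation-basis vector
  (`= ±` the printed product state) is a ground state of `GenHubbard.hamiltonian G p` in the
  half-filled sector `N = |Λ|`, with sector ground energy `#bonds · E_loc`,
  `E_loc = -U/(2Z)`, `-U/(2Z) - J_z/4`, `U/(2Z) - V`, `-U/(2Z) + J_z/4` respectively, on any finite
  graph (bipartite with the given colouring for Néel and CDW).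

PC/CQ pricing: these are the rigorous phase corners of the dBS phase diagram competing with the
`η`-pairing (superconducting) corner of `etaPairing_isGroundState`; all four are finite
sixteen-configuration certificates.
-/

noncomputable section

namespace Literature.MathematicalPhysics.QuantumLattice

namespace GenHubbard

open Matrix Finset HubbardWave0
open scoped ComplexOrder

variable {Λ : Type*} [LinearOrder Λ] [Fintype Λ] (G : SimpleGraph Λ) [DecidableRel G.Adj]

/-! ## The optimal-ground-state lower bound for an arbitrary local target energy -/

/-- **OGS lower bound, general target.** If every bond configuration has Gerschgorin datum at least
`E`, then `E ‖φ‖² ≤ Re ⟨φ, h_{jl} φ⟩` for every `φ`. [cite: deBoerSchadschneider1995, before eq. (1) ("Clearly 0 is a lower bound for the global ground state energy")] -/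
theorem bondHamiltonian_re_expect_ge_of_local (p : Params) {j l : Λ} (hjl : j ≠ l) {E : ℝ}
    (hloc : ∀ α : Finset (Orb Λ), E ≤ diagVal p j l α - offBound p j l α) (φ : Fock (Orb Λ)) :
    E * ∑ a, ‖φ a‖ ^ 2 ≤ (star φ ⬝ᵥ (bondHamiltonian p j l *ᵥ φ)).re :=
  re_quadForm_ge_of_gershgorin_ge (bondHamiltonian_isHermitian p j l) (fun α => by
    rw [bondHamiltonian_apply_self p hjl, Complex.ofReal_re]
    have h1 := hloc α
    have h2 := bondHamiltonian_colOff_le p hjl α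
    unfold colOff at h2
    linarith) φ

/-- **OGS lower bound for `H`, general target**: `#bonds · E · ‖φ‖² ≤ Re ⟨φ, H φ⟩`.
[cite: deBoerSchadschneider1995, before eq. (1)] -/
theorem hamiltonian_re_expect_ge_of_local (p : Params) {E : ℝ}
    (hloc : ∀ j l : Λ, G.Adj j l → ∀ α : Finset (Orb Λ), E ≤ diagVal p j l α - offBound p j l α)
    (φ : Fock (Orb Λ)) :
    bondCount G * E * ∑ a, ‖φ a‖ ^ 2 ≤ (star φ ⬝ᵥ (hamiltonian G p *ᵥ φ)).re := by
  have hterm : ∀ j l : Λ, (if j < l ∧ G.Adj j l then E * ∑ a, ‖φ a‖ ^ 2 else 0) ≤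
      (star φ ⬝ᵥ ((if j < l ∧ G.Adj j l then bondHamiltonian p j l else 0) *ᵥ φ)).re := by
    intro j l
    split_ifs with h
    · exact bondHamiltonian_re_expect_ge_of_local p h.1.ne (hloc j l h.2) φ
    · simp [zero_mulVec]
  have hsum := Finset.sum_le_sum fun j (_ : j ∈ (univ : Finset Λ)) =>
    Finset.sum_le_sum fun l (_ : l ∈ (univ : Finset Λ)) => hterm j l
  rw [sum_sum_ite_bond, nsmul_eq_mul, ← mul_assoc] at hsum
  refine hsum.trans (le_of_eq ?_)
  unfold hamiltonian
  rw [Matrix.sum_mulVec, dotProduct_sum, Complex.re_sum]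
  refine Finset.sum_congr rfl fun j _ => ?_
  rw [Matrix.sum_mulVec, dotProduct_sum, Complex.re_sum]

/-- **A configuration without allowed moves is an eigenvector of the bond Hamiltonian**:
if `offBound p j l α = 0` then `h_{jl} |α⟩ = diagVal |α⟩` (the product state is built from local
eigenstates). [cite: deBoerSchadschneider1995, eq. (2)] -/
theorem mulVec_single_of_offBound_eq_zero (p : Params) {j l : Λ} (hjl : j ≠ l) {α : Finset (Orb Λ)}
    (hα : offBound p j l α = 0) :
    bondHamiltonian p j l *ᵥ (Pi.single α 1 : Fock (Orb Λ)) = ((diagVal p j l α : ℝ) : ℂ) • Pi.single α 1 := by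
  have hcol : ∀ β, β ≠ α → bondHamiltonian p j l β α = 0 := by
    intro β hβ
    have h := bondHamiltonian_colOff_le p hjl α
    rw [hα] at h
    unfold colOff at h
    have hle : ‖bondHamiltonian p j l β α‖ ≤ 0 :=
      le_trans (Finset.single_le_sum (fun b _ => norm_nonneg (bondHamiltonian p j l b α))
        (Finset.mem_erase.2 ⟨hβ, mem_univ β⟩)) h
    exact norm_eq_zero.1 (le_antisymm hle (norm_nonneg _))
  funext β
  rw [Matrix.mulVec_single_one, Pi.smul_apply, smul_eq_mul]
  change bondHamiltonian p j l β α = _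
  by_cases hβ : β = α
  · rw [hβ, bondHamiltonian_apply_self p hjl, Pi.single_eq_same, mul_one]
  · rw [hcol β hβ, Pi.single_eq_of_ne hβ, mul_zero]

/-- **From a local certificate and a move-free configuration to a ground state.** If every bond
configuration has Gerschgorin datum `≥ E` and the configuration `α` (with `#α = n`) is move-free
with `diagVal = E` on every bond, then `|α⟩` is a ground state of `H` in the `n`-particle sector and
the sector ground energy is `#bonds · E`. [cite: deBoerSchadschneider1995, before eq. (1)] -/
theorem single_isGroundState_of_local (p : Params) {E : ℝ}
    (hloc : ∀ j l : Λ, G.Adj j l → ∀ β : Finset (Orb Λ), E ≤ diagVal p j l β - offBound p j l β)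
    {α : Finset (Orb Λ)} (hoff : ∀ j l : Λ, G.Adj j l → offBound p j l α = 0)
    (hdiag : ∀ j l : Λ, G.Adj j l → diagVal p j l α = E) :
    IsGroundState (hamiltonian G p) α.card (Pi.single α 1 : Fock (Orb Λ)) ∧
      groundEnergy (hamiltonian G p) α.card = bondCount G * E := by
  set H := hamiltonian G p with hH
  set ψ : Fock (Orb Λ) := Pi.single α 1 with hψ
  have hHψ : H *ᵥ ψ = ((bondCount G * E : ℝ) : ℂ) • ψ := by
    rw [hH, hamiltonian, Matrix.sum_mulVec]
    have h1 : ∀ j, (∑ l, if j < l ∧ G.Adj j l then bondHamiltonian p j l else 0) *ᵥ ψ =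
        ∑ l, if j < l ∧ G.Adj j l then (E : ℂ) • ψ else 0 := by
      intro j
      rw [Matrix.sum_mulVec]
      refine Finset.sum_congr rfl fun l _ => ?_
      split_ifs with h
      · rw [hψ, mulVec_single_of_offBound_eq_zero p h.1.ne (hoff j l h.2), hdiag j l h.2]
      · exact zero_mulVec _
    simp_rw [h1]
    rw [sum_sum_ite_bond, ← Nat.cast_smul_eq_nsmul ℂ, smul_smul]
    push_cast
    rfl
  have hψN : IsNParticle α.card ψ := fun s hs => by
    rw [hψ, Pi.single_eq_of_ne]
    rintro rfl
    exact hs rfl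
  have hψ0 : ψ ≠ 0 := fun h => by
    have := congrFun h α
    rw [hψ, Pi.single_eq_same] at this
    exact one_ne_zero this
  have hψ1 : star ψ ⬝ᵥ ψ = 1 := by
    rw [hψ, dotProduct_single, Pi.star_apply, Pi.single_eq_same, star_one, one_mul]
  have hle : groundEnergy H α.card ≤ bondCount G * E := by
    have h := ThermodynamicLimit.groundEnergy_le_re_expect H hψN hψ1
    rwa [expect, hHψ, dotProduct_smul, hψ1, smul_eq_mul, mul_one, Complex.ofReal_re] at h
  have hcard : α.card ≤ Fintype.card (Orb Λ) := Finset.card_le_univ α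
  have hge : bondCount G * E ≤ groundEnergy H α.card := by
    refine le_csInf (ThermodynamicLimit.groundEnergySet_nonempty H hcard) ?_
    rintro e ⟨φ, -, hφ1, rfl⟩
    have h := hamiltonian_re_expect_ge_of_local G p hloc φ
    have hn : (star φ ⬝ᵥ φ).re = ∑ a, ‖φ a‖ ^ 2 := by
      simp only [dotProduct, Pi.star_apply, Complex.re_sum]
      refine Finset.sum_congr rfl fun a _ => ?_
      rw [Complex.star_def, Complex.conj_mul', ← Complex.ofReal_pow, Complex.ofReal_re]
    rw [← hn, hφ1, Complex.one_re, mul_one] at h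
    exact h
  have heq : groundEnergy H α.card = bondCount G * E := le_antisymm hle hge
  exact ⟨⟨hψN, hψ0, by rw [heq, hHψ]⟩, heq⟩

/-! ## The sixteen-configuration certificates of de Boer–Schadschneider (13)–(16) -/

/-- The off-diagonal weight with `t = X` factored: `|-t + t m| = |t| |m - 1|`. [cite: deBoerSchadschneider1995, eq. (2)] -/
private theorem abs_hop (t m : ℝ) : |-t + t * m| = |t| * |m - 1| := by
  rw [show -t + t * m = t * (m - 1) by ring, abs_mul]

/-- **(13), paramagnetic**: `t = X`, `J_xy = J_z = 0`, `μ = 0`, `U/Z ≥ max(2|t|, V + |Y|, -V)`: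
every configuration has Gerschgorin datum `≥ -U/(2Z)`. [cite: deBoerSchadschneider1995, eq. (13)] -/
theorem sixteen_configurations_para (t u V Y : ℝ) (h1 : 2 * |t| ≤ u) (h2 : V + |Y| ≤ u)
    (h3 : -V ≤ u) (a b c d : ℝ) (ha : a = 0 ∨ a = 1) (hb : b = 0 ∨ b = 1) (hc : c = 0 ∨ c = 1)
    (hd : d = 0 ∨ d = 1) :
    -(u / 2) ≤
      (u * ((a - 1 / 2) * (b - 1 / 2) + (c - 1 / 2) * (d - 1 / 2)) + V * ((a + b - 1) * (c + d - 1)) +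
          0 / 4 * ((a - b) * (c - d))) -
        ((|-t + t * (b + d)| * (c * (1 - a)) + |-t + t * (d + b)| * (a * (1 - c))) +
            (|-t + t * (a + c)| * (d * (1 - b)) + |-t + t * (c + a)| * (b * (1 - d))) +
          (|Y| * (c * d * (1 - a) * (1 - b)) + |Y| * (a * b * (1 - c) * (1 - d))) +
          (|(0 : ℝ)| / 2 * (c * (1 - d) * b * (1 - a)) + |(0 : ℝ)| / 2 * (a * (1 - b) * d * (1 - c)))) := by
  simp only [abs_hop, abs_zero]
  have h0 := abs_nonneg t
  have h5 := abs_nonneg Y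
  rcases ha with rfl | rfl <;> rcases hb with rfl | rfl <;> rcases hc with rfl | rfl <;>
    rcases hd with rfl | rfl <;> norm_num <;> linarith

/-- **(14), Néel**: `t = X`, `J_xy = 0`, `μ = 0`, `J_z ≥ 0`,
`U/Z ≥ max(-V - J_z/4, 2|t| - J_z/2, V + |Y| - J_z/4)`: every configuration has Gerschgorin datum
`≥ -U/(2Z) - J_z/4`. [cite: deBoerSchadschneider1995, eq. (14)] -/
theorem sixteen_configurations_neel (t u V Y Jz : ℝ) (hJ : 0 ≤ Jz) (h1 : -V - Jz / 4 ≤ u)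
    (h2 : 2 * |t| - Jz / 2 ≤ u) (h3 : V + |Y| - Jz / 4 ≤ u) (a b c d : ℝ) (ha : a = 0 ∨ a = 1)
    (hb : b = 0 ∨ b = 1) (hc : c = 0 ∨ c = 1) (hd : d = 0 ∨ d = 1) :
    -(u / 2) - Jz / 4 ≤
      (u * ((a - 1 / 2) * (b - 1 / 2) + (c - 1 / 2) * (d - 1 / 2)) + V * ((a + b - 1) * (c + d - 1)) +
          Jz / 4 * ((a - b) * (c - d))) -
        ((|-t + t * (b + d)| * (c * (1 - a)) + |-t + t * (d + b)| * (a * (1 - c))) +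
            (|-t + t * (a + c)| * (d * (1 - b)) + |-t + t * (c + a)| * (b * (1 - d))) +
          (|Y| * (c * d * (1 - a) * (1 - b)) + |Y| * (a * b * (1 - c) * (1 - d))) +
          (|(0 : ℝ)| / 2 * (c * (1 - d) * b * (1 - a)) + |(0 : ℝ)| / 2 * (a * (1 - b) * d * (1 - c)))) := by
  simp only [abs_hop, abs_zero]
  have h0 := abs_nonneg t
  have h5 := abs_nonneg Y
  rcases ha with rfl | rfl <;> rcases hb with rfl | rfl <;> rcases hc with rfl | rfl <;>
    rcases hd with rfl | rfl <;> norm_num <;> linarith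

/-- **(15), charge-density wave**: `t = X`, `Y = 0`, `μ = 0`, `V ≥ 0`,
`-U/Z ≥ max(2|t| - 2V, -V - J_z/4, -V + |J_xy|/2 + J_z/4)`: every configuration has Gerschgorin
datum `≥ U/(2Z) - V`. [cite: deBoerSchadschneider1995, eq. (15)] -/
theorem sixteen_configurations_cdw (t u V Jxy Jz : ℝ) (hV : 0 ≤ V) (h1 : 2 * |t| - 2 * V ≤ -u)
    (h2 : -V - Jz / 4 ≤ -u) (h3 : -V + |Jxy| / 2 + Jz / 4 ≤ -u) (a b c d : ℝ) (ha : a = 0 ∨ a = 1)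
    (hb : b = 0 ∨ b = 1) (hc : c = 0 ∨ c = 1) (hd : d = 0 ∨ d = 1) :
    u / 2 - V ≤
      (u * ((a - 1 / 2) * (b - 1 / 2) + (c - 1 / 2) * (d - 1 / 2)) + V * ((a + b - 1) * (c + d - 1)) +
          Jz / 4 * ((a - b) * (c - d))) -
        ((|-t + t * (b + d)| * (c * (1 - a)) + |-t + t * (d + b)| * (a * (1 - c))) +
            (|-t + t * (a + c)| * (d * (1 - b)) + |-t + t * (c + a)| * (b * (1 - d))) +
          (|(0 : ℝ)| * (c * d * (1 - a) * (1 - b)) + |(0 : ℝ)| * (a * b * (1 - c) * (1 - d))) +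
          (|Jxy| / 2 * (c * (1 - d) * b * (1 - a)) + |Jxy| / 2 * (a * (1 - b) * d * (1 - c)))) := by
  simp only [abs_hop, abs_zero]
  have h0 := abs_nonneg t
  have h5 := abs_nonneg Jxy
  rcases ha with rfl | rfl <;> rcases hb with rfl | rfl <;> rcases hc with rfl | rfl <;>
    rcases hd with rfl | rfl <;> norm_num <;> linarith

/-- **(16) at `t = X`, ferromagnet**: `μ = 0`, `-J_z ≥ |J_xy|`,
`U/Z ≥ max(2|t| + J_z/2, J_z/4 - V, V + |Y| + J_z/4)`: every configuration has Gerschgorin datum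
`≥ -U/(2Z) + J_z/4`. [cite: deBoerSchadschneider1995, eq. (16)] -/
theorem sixteen_configurations_ferro (t u V Y Jxy Jz : ℝ) (hJ : |Jxy| ≤ -Jz) (h1 : 2 * |t| + Jz / 2 ≤ u)
    (h2 : Jz / 4 - V ≤ u) (h3 : V + |Y| + Jz / 4 ≤ u) (a b c d : ℝ) (ha : a = 0 ∨ a = 1)
    (hb : b = 0 ∨ b = 1) (hc : c = 0 ∨ c = 1) (hd : d = 0 ∨ d = 1) :
    -(u / 2) + Jz / 4 ≤
      (u * ((a - 1 / 2) * (b - 1 / 2) + (c - 1 / 2) * (d - 1 / 2)) + V * ((a + b - 1) * (c + d - 1)) +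
          Jz / 4 * ((a - b) * (c - d))) -
        ((|-t + t * (b + d)| * (c * (1 - a)) + |-t + t * (d + b)| * (a * (1 - c))) +
            (|-t + t * (a + c)| * (d * (1 - b)) + |-t + t * (c + a)| * (b * (1 - d))) +
          (|Y| * (c * d * (1 - a) * (1 - b)) + |Y| * (a * b * (1 - c) * (1 - d))) +
          (|Jxy| / 2 * (c * (1 - d) * b * (1 - a)) + |Jxy| / 2 * (a * (1 - b) * d * (1 - c)))) := by
  simp only [abs_hop]
  have h0 := abs_nonneg t
  have h5 := abs_nonneg Y
  have h6 := abs_nonneg Jxy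
  rcases ha with rfl | rfl <;> rcases hb with rfl | rfl <;> rcases hc with rfl | rfl <;>
    rcases hd with rfl | rfl <;> norm_num <;> linarith

/-- **de Boer–Schadschneider's region (13)** (paramagnetic product states at half filling, `μ = 0`):
`t = X`, `J_xy = J_z = 0`, `U/Z ≥ max(2|t|, V + |Y|, -V)`. [cite: deBoerSchadschneider1995, eq. (13)] -/
structure ParaInequalities (p : Params) : Prop where
  ht : p.X = p.t
  hJxy : p.Jxy = 0
  hJz : p.Jz = 0
  hμ : p.μ = 0
  h1 : 2 * |p.t| ≤ p.U / p.Z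
  h2 : p.V + |p.Y| ≤ p.U / p.Z
  h3 : -p.V ≤ p.U / p.Z

/-- **de Boer–Schadschneider's region (14)** (Néel state at half filling, `μ = 0`): `t = X`,
`J_xy = 0`, `J_z ≥ 0`, `U/Z ≥ max(-V - J_z/4, 2|t| - J_z/2, V + |Y| - J_z/4)`.
[cite: deBoerSchadschneider1995, eq. (14)] -/
structure NeelInequalities (p : Params) : Prop where
  ht : p.X = p.t
  hJxy : p.Jxy = 0
  hμ : p.μ = 0
  hJz : 0 ≤ p.Jz
  h1 : -p.V - p.Jz / 4 ≤ p.U / p.Z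
  h2 : 2 * |p.t| - p.Jz / 2 ≤ p.U / p.Z
  h3 : p.V + |p.Y| - p.Jz / 4 ≤ p.U / p.Z

/-- **de Boer–Schadschneider's region (15)** (charge-density wave at half filling, `μ = 0`):
`t = X`, `Y = 0`, `V ≥ 0`, `-U/Z ≥ max(2|t| - 2V, -V - J_z/4, -V + |J_xy|/2 + J_z/4)`.
[cite: deBoerSchadschneider1995, eq. (15)] -/
structure CDWInequalities (p : Params) : Prop where
  ht : p.X = p.t
  hY : p.Y = 0
  hμ : p.μ = 0
  hV : 0 ≤ p.V
  h1 : 2 * |p.t| - 2 * p.V ≤ -(p.U / p.Z)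
  h2 : -p.V - p.Jz / 4 ≤ -(p.U / p.Z)
  h3 : -p.V + |p.Jxy| / 2 + p.Jz / 4 ≤ -(p.U / p.Z)

/-- **de Boer–Schadschneider's region (16) at `t = X`** (saturated ferromagnet at half filling,
`μ = 0`): `-J_z ≥ |J_xy|`, `U/Z ≥ max(2|t| + J_z/2, J_z/4 - V, V + |Y| + J_z/4)`.
[cite: deBoerSchadschneider1995, eq. (16)] -/
structure FerroInequalities (p : Params) : Prop where
  ht : p.X = p.t
  hμ : p.μ = 0
  hJ : |p.Jxy| ≤ -p.Jz
  h1 : 2 * |p.t| + p.Jz / 2 ≤ p.U / p.Z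
  h2 : p.Jz / 4 - p.V ≤ p.U / p.Z
  h3 : p.V + |p.Y| + p.Jz / 4 ≤ p.U / p.Z

omit [Fintype Λ] in
/-- Unfolding of the Gerschgorin datum of a configuration into the sixteen-configuration form.
[cite: deBoerSchadschneider1995, eq. (2)] -/
private theorem diagVal_sub_offBound_eq (p : Params) (ht : p.X = p.t) (hμ : p.μ = 0) (j l : Λ)
    (α : Finset (Orb Λ)) :
    diagVal p j l α - offBound p j l α =
      (p.U / p.Z * ((occ α (orb j 0) - 1 / 2) * (occ α (orb j 1) - 1 / 2) +
            (occ α (orb l 0) - 1 / 2) * (occ α (orb l 1) - 1 / 2)) +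
          p.V * ((occ α (orb j 0) + occ α (orb j 1) - 1) * (occ α (orb l 0) + occ α (orb l 1) - 1)) +
          p.Jz / 4 * ((occ α (orb j 0) - occ α (orb j 1)) * (occ α (orb l 0) - occ α (orb l 1)))) -
        ((|-p.t + p.t * (occ α (orb j 1) + occ α (orb l 1))| * (occ α (orb l 0) * (1 - occ α (orb j 0))) +
              |-p.t + p.t * (occ α (orb l 1) + occ α (orb j 1))| * (occ α (orb j 0) * (1 - occ α (orb l 0)))) +
            (|-p.t + p.t * (occ α (orb j 0) + occ α (orb l 0))| * (occ α (orb l 1) * (1 - occ α (orb j 1))) +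
              |-p.t + p.t * (occ α (orb l 0) + occ α (orb j 0))| * (occ α (orb j 1) * (1 - occ α (orb l 1)))) +
          (|p.Y| * (occ α (orb l 0) * occ α (orb l 1) * (1 - occ α (orb j 0)) * (1 - occ α (orb j 1))) +
            |p.Y| * (occ α (orb j 0) * occ α (orb j 1) * (1 - occ α (orb l 0)) * (1 - occ α (orb l 1)))) +
          (|p.Jxy| / 2 * (occ α (orb l 0) * (1 - occ α (orb l 1)) * occ α (orb j 1) * (1 - occ α (orb j 0))) +
            |p.Jxy| / 2 * (occ α (orb j 0) * (1 - occ α (orb j 1)) * occ α (orb l 1) * (1 - occ α (orb l 0))))) := by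
  simp only [diagVal, diagFormula, offBound, hopWeight, pairWeight, flipWeight, Fin.sum_univ_two,
    flipSpin_zero, flipSpin_one, ht, hμ, zero_div, zero_mul, add_zero]

omit [Fintype Λ] in
/-- Local certificate in region (13). [cite: deBoerSchadschneider1995, eq. (13)] -/
theorem localGershgorin_ge_para (p : Params) (hI : ParaInequalities p) (j l : Λ) (α : Finset (Orb Λ)) :
    -(p.U / p.Z / 2) ≤ diagVal p j l α - offBound p j l α := by
  have h := sixteen_configurations_para p.t (p.U / p.Z) p.V p.Y hI.h1 hI.h2 hI.h3
    (occ α (orb j 0)) (occ α (orb j 1)) (occ α (orb l 0)) (occ α (orb l 1))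
    (occ_eq_zero_or_one _ _) (occ_eq_zero_or_one _ _) (occ_eq_zero_or_one _ _) (occ_eq_zero_or_one _ _)
  rw [diagVal_sub_offBound_eq p hI.ht hI.hμ, hI.hJxy, hI.hJz]
  linarith

omit [Fintype Λ] in
/-- Local certificate in region (14). [cite: deBoerSchadschneider1995, eq. (14)] -/
theorem localGershgorin_ge_neel (p : Params) (hI : NeelInequalities p) (j l : Λ) (α : Finset (Orb Λ)) :
    -(p.U / p.Z / 2) - p.Jz / 4 ≤ diagVal p j l α - offBound p j l α := by
  have h := sixteen_configurations_neel p.t (p.U / p.Z) p.V p.Y p.Jz hI.hJz hI.h1 hI.h2 hI.h3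
    (occ α (orb j 0)) (occ α (orb j 1)) (occ α (orb l 0)) (occ α (orb l 1))
    (occ_eq_zero_or_one _ _) (occ_eq_zero_or_one _ _) (occ_eq_zero_or_one _ _) (occ_eq_zero_or_one _ _)
  rw [diagVal_sub_offBound_eq p hI.ht hI.hμ, hI.hJxy]
  linarith

omit [Fintype Λ] in
/-- Local certificate in region (15). [cite: deBoerSchadschneider1995, eq. (15)] -/
theorem localGershgorin_ge_cdw (p : Params) (hI : CDWInequalities p) (j l : Λ) (α : Finset (Orb Λ)) :
    p.U / p.Z / 2 - p.V ≤ diagVal p j l α - offBound p j l α := by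
  have h := sixteen_configurations_cdw p.t (p.U / p.Z) p.V p.Jxy p.Jz hI.hV hI.h1 hI.h2 hI.h3
    (occ α (orb j 0)) (occ α (orb j 1)) (occ α (orb l 0)) (occ α (orb l 1))
    (occ_eq_zero_or_one _ _) (occ_eq_zero_or_one _ _) (occ_eq_zero_or_one _ _) (occ_eq_zero_or_one _ _)
  rw [diagVal_sub_offBound_eq p hI.ht hI.hμ, hI.hY]
  linarith

omit [Fintype Λ] in
/-- Local certificate in region (16) at `t = X`. [cite: deBoerSchadschneider1995, eq. (16)] -/
theorem localGershgorin_ge_ferro (p : Params) (hI : FerroInequalities p) (j l : Λ) (α : Finset (Orb Λ)) :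
    -(p.U / p.Z / 2) + p.Jz / 4 ≤ diagVal p j l α - offBound p j l α := by
  have h := sixteen_configurations_ferro p.t (p.U / p.Z) p.V p.Y p.Jxy p.Jz hI.hJ hI.h1 hI.h2 hI.h3
    (occ α (orb j 0)) (occ α (orb j 1)) (occ α (orb l 0)) (occ α (orb l 1))
    (occ_eq_zero_or_one _ _) (occ_eq_zero_or_one _ _) (occ_eq_zero_or_one _ _) (occ_eq_zero_or_one _ _)
  rw [diagVal_sub_offBound_eq p hI.ht hI.hμ]
  linarith

/-! ## The four product states and their ground-state property -/

/-- The Ising (spin) configuration with the sites of `A` occupied by an `↑` electron and all other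
sites by a `↓` electron: the occupation set of de Boer–Schadschneider's `|para⟩` (eq. (11), `A' = Λ ∖ A`)
and, for `A` a class of a bipartite lattice, of `|Neel⟩`. [cite: deBoerSchadschneider1995, eq. (11)] -/
def spinConfig (A : Finset Λ) : Finset (Orb Λ) :=
  univ.filter fun i => ((ofLex i).1 ∈ A ∧ (ofLex i).2 = 0) ∨ ((ofLex i).1 ∉ A ∧ (ofLex i).2 = 1)

/-- The saturated ferromagnetic configuration (every site carries an `↑` electron): the occupation
set of `|F⟩ = Π_j c†_{j↑} |0⟩`. [cite: deBoerSchadschneider1995, eq. (12)] -/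
def ferroConfig : Finset (Orb Λ) := univ.filter fun i => (ofLex i).2 = 0

/-- Occupations of the Ising configuration. [cite: deBoerSchadschneider1995, eq. (11)] -/
theorem orb_mem_spinConfig (A : Finset Λ) (x : Λ) (σ : Fin 2) :
    orb x σ ∈ spinConfig A ↔ (x ∈ A ∧ σ = 0) ∨ (x ∉ A ∧ σ = 1) := by
  simp [spinConfig, orb]

omit [LinearOrder Λ] in
/-- Occupations of the ferromagnetic configuration. [cite: deBoerSchadschneider1995, eq. (12)] -/
theorem orb_mem_ferroConfig (x : Λ) (σ : Fin 2) : orb x σ ∈ (ferroConfig : Finset (Orb Λ)) ↔ σ = 0 := by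
  simp [ferroConfig, orb]

/-- The Ising configuration as the image of the site set. [cite: deBoerSchadschneider1995, eq. (11)] -/
theorem spinConfig_eq_image (A : Finset Λ) :
    spinConfig A = univ.image fun x : Λ => orb x (if x ∈ A then 0 else 1) := by
  ext i
  obtain ⟨⟨x, σ⟩, rfl⟩ := toLex.surjective i
  rw [show toLex (x, σ) = orb x σ from rfl, orb_mem_spinConfig, Finset.mem_image]
  constructor
  · rintro (⟨hx, rfl⟩ | ⟨hx, rfl⟩)
    · exact ⟨x, mem_univ _, by rw [if_pos hx]⟩
    · exact ⟨x, mem_univ _, by rw [if_neg hx]⟩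
  · rintro ⟨y, -, hy⟩
    obtain ⟨rfl, hσ⟩ := orb_eq_orb_iff.1 hy
    by_cases hx : y ∈ A
    · rw [if_pos hx] at hσ; exact Or.inl ⟨hx, hσ.symm⟩
    · rw [if_neg hx] at hσ; exact Or.inr ⟨hx, hσ.symm⟩

/-- The Ising configuration is half filled: `#spinConfig A = |Λ|`. [cite: deBoerSchadschneider1995, eq. (11)] -/
theorem card_spinConfig (A : Finset Λ) : (spinConfig A).card = Fintype.card Λ := by
  rw [spinConfig_eq_image, Finset.card_image_of_injective _ (fun x y h => (orb_eq_orb_iff.1 h).1),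
    Finset.card_univ]

/-- The ferromagnetic configuration as the image of the site set. [cite: deBoerSchadschneider1995, eq. (12)] -/
theorem ferroConfig_eq_image : (ferroConfig : Finset (Orb Λ)) = univ.image fun x : Λ => orb x 0 := by
  ext i
  obtain ⟨⟨x, σ⟩, rfl⟩ := toLex.surjective i
  rw [show toLex (x, σ) = orb x σ from rfl, orb_mem_ferroConfig, Finset.mem_image]
  constructor
  · rintro rfl
    exact ⟨x, mem_univ _, rfl⟩
  · rintro ⟨y, -, hy⟩
    exact ((orb_eq_orb_iff.1 hy).2).symm

/-- The ferromagnetic configuration is half filled. [cite: deBoerSchadschneider1995, eq. (12)] -/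
theorem card_ferroConfig : (ferroConfig : Finset (Orb Λ)).card = Fintype.card Λ := by
  rw [ferroConfig_eq_image, Finset.card_image_of_injective _ (fun x y h => (orb_eq_orb_iff.1 h).1),
    Finset.card_univ]

omit [LinearOrder Λ] [Fintype Λ] in
/-- The CDW configuration is half filled on a balanced bipartition: `#pairConfig B = 2 #B`.
[cite: deBoerSchadschneider1995, eq. (11)] -/
theorem card_pairConfig (B : Finset Λ) : (pairConfig B).card = 2 * B.card := by
  rw [pairConfig, Finset.card_map, Finset.card_product, Finset.card_univ, Fintype.card_fin, mul_comm]

/-- Occupation numbers of the Ising configuration. [cite: deBoerSchadschneider1995, eq. (11)] -/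
theorem occ_spinConfig (A : Finset Λ) (x : Λ) :
    occ (spinConfig A) (orb x 0) = (if x ∈ A then 1 else 0) ∧
      occ (spinConfig A) (orb x 1) = (if x ∈ A then 0 else 1) := by
  unfold occ
  simp only [orb_mem_spinConfig]
  by_cases hx : x ∈ A <;> simp [hx]

/-- Occupation numbers of the ferromagnetic configuration. [cite: deBoerSchadschneider1995, eq. (12)] -/
theorem occ_ferroConfig (x : Λ) :
    occ (ferroConfig : Finset (Orb Λ)) (orb x 0) = 1 ∧ occ (ferroConfig : Finset (Orb Λ)) (orb x 1) = 0 := by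
  unfold occ
  simp [orb_mem_ferroConfig]

/-- **(13) Paramagnetic product states are ground states.** In region (13), for EVERY subset
`A ⊆ Λ` the half-filled Ising configuration (`↑` on `A`, `↓` elsewhere; `= ±|para⟩`) is a ground
state of the generalized Hubbard Hamiltonian in the `|Λ|`-particle sector, on any finite graph, with
sector ground energy `#bonds · (-U/(2Z))`. [cite: deBoerSchadschneider1995, eq. (13)] -/
theorem para_isGroundState (p : Params) (hI : ParaInequalities p) (A : Finset Λ) :
    IsGroundState (hamiltonian G p) (Fintype.card Λ) (Pi.single (spinConfig A) 1 : Fock (Orb Λ)) ∧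
      groundEnergy (hamiltonian G p) (Fintype.card Λ) = bondCount G * (-(p.U / p.Z / 2)) := by
  rw [← card_spinConfig A]
  refine single_isGroundState_of_local G p (fun j l _ β => localGershgorin_ge_para p hI j l β)
    (fun j l h => ?_) (fun j l h => ?_)
  · have hj := occ_spinConfig A j
    have hl := occ_spinConfig A l
    simp only [offBound, hopWeight, pairWeight, flipWeight, Fin.sum_univ_two, flipSpin_zero, flipSpin_one,
      hI.ht, hI.hJxy, hj.1, hj.2, hl.1, hl.2, abs_zero, zero_div, zero_mul, add_zero]
    by_cases hjA : j ∈ A <;> by_cases hlA : l ∈ A <;> simp [hjA, hlA]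
  · have hj := occ_spinConfig A j
    have hl := occ_spinConfig A l
    simp only [diagVal, diagFormula, hI.hJz, hI.hμ, hj.1, hj.2, hl.1, hl.2, zero_div, zero_mul, add_zero]
    by_cases hjA : j ∈ A <;> by_cases hlA : l ∈ A <;> simp [hjA, hlA] <;> ring

/-- **(14) The Néel state is a ground state.** In region (14), on a graph with a bipartite
colouring `A` (every edge joins `A` and `Λ ∖ A`), the half-filled Néel configuration (`↑` on `A`,
`↓` on `Λ ∖ A`; `= ±|Neel⟩`) is a ground state in the `|Λ|`-particle sector, with sector ground
energy `#bonds · (-U/(2Z) - J_z/4)`. [cite: deBoerSchadschneider1995, eq. (14)] -/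
theorem neel_isGroundState (p : Params) (hI : NeelInequalities p) (A : Finset Λ)
    (hA : ∀ x y : Λ, G.Adj x y → (x ∈ A ↔ y ∉ A)) :
    IsGroundState (hamiltonian G p) (Fintype.card Λ) (Pi.single (spinConfig A) 1 : Fock (Orb Λ)) ∧
      groundEnergy (hamiltonian G p) (Fintype.card Λ) = bondCount G * (-(p.U / p.Z / 2) - p.Jz / 4) := by
  rw [← card_spinConfig A]
  refine single_isGroundState_of_local G p (fun j l _ β => localGershgorin_ge_neel p hI j l β)
    (fun j l h => ?_) (fun j l h => ?_)
  · have hj := occ_spinConfig A j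
    have hl := occ_spinConfig A l
    have hjl := hA j l h
    simp only [offBound, hopWeight, pairWeight, flipWeight, Fin.sum_univ_two, flipSpin_zero, flipSpin_one,
      hI.ht, hI.hJxy, hj.1, hj.2, hl.1, hl.2, abs_zero, zero_div, zero_mul, add_zero]
    by_cases hjA : j ∈ A
    · have hlA : l ∉ A := hjl.1 hjA
      simp [hjA, hlA]
    · have hlA : l ∈ A := by by_contra h'; exact hjA (hjl.2 h')
      simp [hjA, hlA]
  · have hj := occ_spinConfig A j
    have hl := occ_spinConfig A l
    have hjl := hA j l h
    simp only [diagVal, diagFormula, hI.hμ, hj.1, hj.2, hl.1, hl.2, zero_div, zero_mul, add_zero]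
    by_cases hjA : j ∈ A
    · have hlA : l ∉ A := hjl.1 hjA
      simp [hjA, hlA]; ring
    · have hlA : l ∈ A := by by_contra h'; exact hjA (hjl.2 h')
      simp [hjA, hlA]; ring

/-- **(15) The charge-density wave is a ground state.** In region (15), on a graph with a
bipartite colouring `B`, the configuration with the sites of `B` doubly occupied and the others
empty (`= |CDW⟩`, tree `pairConfig B`) is a ground state in the `2#B`-particle sector (half
filling when `2#B = |Λ|`), with sector ground energy `#bonds · (U/(2Z) - V)`.
[cite: deBoerSchadschneider1995, eq. (15)] -/
theorem cdw_isGroundState (p : Params) (hI : CDWInequalities p) (B : Finset Λ)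
    (hB : ∀ x y : Λ, G.Adj x y → (x ∈ B ↔ y ∉ B)) :
    IsGroundState (hamiltonian G p) (2 * B.card) (Pi.single (pairConfig B) 1 : Fock (Orb Λ)) ∧
      groundEnergy (hamiltonian G p) (2 * B.card) = bondCount G * (p.U / p.Z / 2 - p.V) := by
  rw [← card_pairConfig B]
  refine single_isGroundState_of_local G p (fun j l _ β => localGershgorin_ge_cdw p hI j l β)
    (fun j l h => ?_) (fun j l h => ?_)
  · have hjl := hB j l h
    simp only [offBound, hopWeight, pairWeight, flipWeight, Fin.sum_univ_two,
      hI.ht, hI.hY, occ_pairConfig, abs_zero, zero_mul, add_zero]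
    by_cases hjB : j ∈ B
    · have hlB : l ∉ B := hjl.1 hjB
      simp [hjB, hlB]
    · have hlB : l ∈ B := by by_contra h'; exact hjB (hjl.2 h')
      simp [hjB, hlB]
  · have hjl := hB j l h
    simp only [diagVal, diagFormula, hI.hμ, occ_pairConfig, zero_div, zero_mul, add_zero]
    by_cases hjB : j ∈ B
    · have hlB : l ∉ B := hjl.1 hjB
      simp [hjB, hlB]; ring
    · have hlB : l ∈ B := by by_contra h'; exact hjB (hjl.2 h')
      simp [hjB, hlB]; ring

/-- **(16) at `t = X`: the saturated ferromagnet is a ground state.** In region (16) (`t = X`)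
the half-filled configuration with an `↑` electron on every site (`= ±|F⟩`) is a ground state in
the `|Λ|`-particle sector on any finite graph, with sector ground energy `#bonds · (-U/(2Z) + J_z/4)`.
[cite: deBoerSchadschneider1995, eq. (16)] -/
theorem ferro_isGroundState (p : Params) (hI : FerroInequalities p) :
    IsGroundState (hamiltonian G p) (Fintype.card Λ) (Pi.single (ferroConfig : Finset (Orb Λ)) 1) ∧
      groundEnergy (hamiltonian G p) (Fintype.card Λ) = bondCount G * (-(p.U / p.Z / 2) + p.Jz / 4) := by
  rw [← card_ferroConfig (Λ := Λ)]
  refine single_isGroundState_of_local G p (fun j l _ β => localGershgorin_ge_ferro p hI j l β)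
    (fun j l _ => ?_) (fun j l _ => ?_)
  · have hj := occ_ferroConfig (Λ := Λ) j
    have hl := occ_ferroConfig (Λ := Λ) l
    simp only [offBound, hopWeight, pairWeight, flipWeight, Fin.sum_univ_two, flipSpin_zero, flipSpin_one,
      hj.1, hj.2, hl.1, hl.2]
    norm_num
  · have hj := occ_ferroConfig (Λ := Λ) j
    have hl := occ_ferroConfig (Λ := Λ) l
    simp only [diagVal, diagFormula, hI.hμ, hj.1, hj.2, hl.1, hl.2]
    norm_num
    ring

end GenHubbard

end Literature.MathematicalPhysics.QuantumLattice
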